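import Summits.AnomalousDissipation.AnomalousDissipation.Theses.SteadyWeakLimit
import HarnessLib

/-!
# Route SteadyWeakLimit — the support `ProductionIdentity`

Proof of the route declaration
`Summit.AnomalousDissipation.AnomalousDissipation.Theses.SteadyWeakLimit.ProductionIdentity`
(item stmt-AnomalousDissipation-1308): for a smooth stationary Euler–Reynolds subsolution
`(v·∇)v + ∇p + div R = f` on `T³` with `div v = 0` (`R` a smooth `2`-tensor field stored by
columns, `R x j = R(x) eⱼ`, the convention of `FluidPDE.Torus.tensorDivergence`), the injected power
equals the turbulent production,

  `∫ ⟪f, v⟫ = -∫ ∑ⱼ ⟪R^{(j)}, ∂ⱼ v⟫`.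

Pair the pointwise identity with `v` and integrate over the torus: the transport term vanishes,
`∫ ⟪(v·∇)v, v⟫ = 0` (`Torus.integral_inner_convect_self_eq_zero`, `div v = 0`), the pressure term
vanishes, `∫ ⟪∇p, v⟫ = 0` (`Torus.integral_inner_gradient_eq_zero_of_isDivFree`), and the stress
term is integrated by parts column-wise (`FluidPDE.Torus.integral_inner_tensorDivergence`). No
symmetry or trace condition on `R` is needed. (RANS energetics for subsolutions; DiPerna–Majda 1987,
De Lellis–Székelyhidi 2012.)
-/

namespace Summit.AnomalousDissipation.AnomalousDissipation.Theorems

-- the mandated namespace `Summit.<Summit>.<Problem>.Theorems` repeats `AnomalousDissipation` (single-problem summit)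
set_option linter.dupNamespace false

open MeasureTheory
open scoped InnerProductSpace
open Literature.Analysis.FunctionSpaces
open Summit.AnomalousDissipation.AnomalousDissipation.Theses.SteadyWeakLimit

/-- **Production identity for smooth stationary Euler–Reynolds subsolutions.**
If `v, f, p, R` are smooth on `T³`, `div v = 0` and `(v·∇)v + ∇p + div R = f` pointwise, then
`∫ ⟪f, v⟫ = -∫ ∑ⱼ ⟪R^{(j)}, ∂ⱼ v⟫`: pairing with `v`, the transport and pressure terms integrate to
zero and the stress term is integrated by parts. Closes item stmt-AnomalousDissipation-1308. -/
theorem productionIdentity_proof :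
    Summit.AnomalousDissipation.AnomalousDissipation.Theses.SteadyWeakLimit.ProductionIdentity := by
  unfold ProductionIdentity
  intro v f p R hv _hf hp hR hdiv heq
  -- smoothness of the three summands of the left-hand side
  have hc : Torus.IsSmooth (Torus.convect v v) := hv.convect hv
  have hg : Torus.IsSmooth (Torus.gradient p) := hp.gradient
  have hT : Torus.IsSmooth (Literature.Analysis.FluidPDE.Torus.tensorDivergence R) := hR.tensorDivergence
  -- rewrite `f` through the equation and split the integral
  have hfeq : (fun x => ⟪f x, v x⟫_ℝ) = fun x =>
      ⟪Torus.convect v v x, v x⟫_ℝ + ⟪Torus.gradient p x, v x⟫_ℝ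
        + ⟪Literature.Analysis.FluidPDE.Torus.tensorDivergence R x, v x⟫_ℝ := by
    funext x
    rw [← heq x, inner_add_left, inner_add_left]
  -- integrability of the summands (smooth functions on the compact torus)
  have i1 : Integrable (fun x => ⟪Torus.convect v v x, v x⟫_ℝ) := (hc.inner hv).integrable
  have i2 : Integrable (fun x => ⟪Torus.gradient p x, v x⟫_ℝ) := (hg.inner hv).integrable
  have i3 : Integrable
      (fun x => ⟪Literature.Analysis.FluidPDE.Torus.tensorDivergence R x, v x⟫_ℝ) :=
    (hT.inner hv).integrable
  have i12 : Integrable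
      (fun x => ⟪Torus.convect v v x, v x⟫_ℝ + ⟪Torus.gradient p x, v x⟫_ℝ) := i1.add i2
  rw [hfeq, integral_add i12 i3, integral_add i1 i2,
    Torus.integral_inner_convect_self_eq_zero hv hdiv,
    Torus.integral_inner_gradient_eq_zero_of_isDivFree hv hp hdiv,
    Literature.Analysis.FluidPDE.Torus.integral_inner_tensorDivergence hR hv]
  simp

end Summit.AnomalousDissipation.AnomalousDissipation.Theorems
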